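import Summits.ValiantsHypothesis.ValiantsHypothesis.Theorems.KPlusLogSqLawStaticReduction
import Summits.ValiantsHypothesis.ValiantsHypothesis.Theorems.KPlusLogSqLawTropicalBSplitDefs

/-!
# Route «KPlusLogSqLaw» — preliminaries for the static CYCLIC-BAND law: chain injectivity, restriction, subsequences, column swaps, forced rotations

HONEST FRAMING.  Helper lemmas (part 1 of 2) toward the crux `WeakLifting` (item `stmt-ValiantsHypothesis-19561`, route `KPlusLogSqLaw`, cell
`pub-symmetroid`, seat val-sym-lift-p3 g7, 2026-08-27), used by `…StaticCyclicBand` (part 2: dominant chains of static cyclic-band designs are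
`O(m log m)`, with `K` classes `O(K m² log m)`).  All in the tree's `IsDominant` vocabulary, valid for every design:
* (chain injectivity is the tree's `injective_of_chainD`, `…TropicalBSplitDefs`: slopes strictly increase along an unsigned chain);
* `isDominant_restrict` — deleting entries not used by a dominant term keeps it dominant;
* `card_le_of_subchain` — the indices of a chain whose (injectively transformed) terms are dominant for an auxiliary design number at most `L + 1`
  if that design's chains have length `≤ L` (re-indexing by `Finset.orderEmbOfFin`);
* `tropWeight_colSwap`, `termSign_colSwap`, `isDominant_colSwap`, `colSwap_injective` — permuting the COLUMNS of the design and of the terms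
  simultaneously (`q ↦ (σ·τ, λ∘τ)`) keeps weights, multiplies signs by `sign τ`, and transfers dominance;
* `perm_val_of_corner₁/₂` — a permutation using the corner `(0, m−1)` (resp. `(m−1, 0)`) whose other columns stay in the band `|i − j| ≤ 1` is the
  rotation `j ↦ j+1` (resp. `j ↦ j−1`) (`m ≥ 3`).
Nothing here asserts anything about `WeakLifting`, `TropicalB`, `KPlusLogSqLaw`, `MatrixDescartes` (stmt-ValiantsHypothesis-18050) or `VP ≠ VNP`.
[folklore]
-/

set_option linter.dupNamespace false
set_option autoImplicit false

namespace Summit.ValiantsHypothesis.ValiantsHypothesis.Theorems.KPlusLogSqLaw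

open Finset Classical
open Summit.ValiantsHypothesis.ValiantsHypothesis.Theorems.MatrixDescartes.Negative

namespace StaticCyclicBand

variable {m K : ℕ}

/-! ## 1. Generic chain facts: deletion of unused entries, subsequences -/

/-- **deleting unused entries preserves dominance**: if `ε'` agrees with `ε` wherever `ε'` is present, and `q` is `ε'`-present and `ε`-dominant,
then `q` is `ε'`-dominant. [folklore] -/
theorem isDominant_restrict (d : Fin K → ℕ) (v ε ε' : Fin m → Fin m → Fin K → ℤ) (hsub : ∀ i j l, ε' i j l ≠ 0 → ε' i j l = ε i j l)
    (θ : ℤ) {q : Equiv.Perm (Fin m) × (Fin m → Fin K)} (hq : IsDominant d v ε θ q) (hpres : termSign ε' q ≠ 0) :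
    IsDominant d v ε' θ q := by
  refine ⟨hpres, fun q' hne hq' => hq.2 q' hne ?_⟩
  unfold termSign at hq' ⊢
  have hprod : ∏ i, ε' (q'.1 i) i (q'.2 i) ≠ 0 := fun h => hq' (by rw [h, mul_zero])
  rw [prod_ne_zero_iff] at hprod
  have : ∏ i, ε (q'.1 i) i (q'.2 i) = ∏ i, ε' (q'.1 i) i (q'.2 i) :=
    prod_congr rfl fun i _ => (hsub _ _ _ (hprod i (mem_univ i))).symm
  rw [this]
  exact hq'

/-- **subsequence bound**: if the terms at the indices of `S`, transformed by an injective map `f`, are dominant for a design all of whose chains of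
distinct consecutive dominant terms have length `≤ L`, then `|S| ≤ L + 1`. [folklore] -/
theorem card_le_of_subchain {m' : ℕ} (d : Fin K → ℕ) (v ε : Fin m → Fin m → Fin K → ℤ) (v' ε' : Fin m' → Fin m' → Fin K → ℤ)
    {n : ℕ} (θ : Fin (n + 1) → ℤ) (p : Fin (n + 1) → Equiv.Perm (Fin m) × (Fin m → Fin K)) (hθ : StrictMono θ)
    (hdom : ∀ k, IsDominant d v ε (θ k) (p k)) (hne : ∀ k : Fin n, p k.castSucc ≠ p k.succ)
    (f : Equiv.Perm (Fin m) × (Fin m → Fin K) → Equiv.Perm (Fin m') × (Fin m' → Fin K)) (hf : Function.Injective f)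
    (S : Finset (Fin (n + 1))) (hS : ∀ k ∈ S, IsDominant d v' ε' (θ k) (f (p k))) (L : ℕ)
    (hL : ∀ (n' : ℕ) (θ' : Fin (n' + 1) → ℤ) (p' : Fin (n' + 1) → Equiv.Perm (Fin m') × (Fin m' → Fin K)), StrictMono θ' →
      (∀ k, IsDominant d v' ε' (θ' k) (p' k)) → (∀ k : Fin n', p' k.castSucc ≠ p' k.succ) → n' ≤ L) :
    S.card ≤ L + 1 := by
  rcases Nat.eq_zero_or_pos S.card with h0 | hpos
  · rw [h0]; exact Nat.zero_le _
  obtain ⟨M, hM⟩ : ∃ M, S.card = M + 1 := ⟨S.card - 1, by omega⟩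
  set ι := S.orderEmbOfFin hM with hι
  have hιS : ∀ t, ι t ∈ S := fun t => orderEmbOfFin_mem S hM t
  have hinj := injective_of_chainD d v ε θ p hθ hdom hne
  have hdist : ∀ t : Fin M, f (p (ι t.castSucc)) ≠ f (p (ι t.succ)) := by
    intro t heq
    have hlt' : t.castSucc < t.succ := Fin.castSucc_lt_succ
    exact hlt'.ne (ι.injective (hinj (hf heq)))
  have key := hL M (fun t => θ (ι t)) (fun t => f (p (ι t))) (hθ.comp ι.strictMono) (fun t => hS _ (hιS t)) hdist
  omega

/-! ## 2. The column swap -/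

/-- weights are invariant under a simultaneous column permutation of the design and the term. [folklore] -/
theorem tropWeight_colSwap (d : Fin K → ℕ) (v : Fin m → Fin m → Fin K → ℤ) (τ : Equiv.Perm (Fin m)) (θ : ℤ)
    (q : Equiv.Perm (Fin m) × (Fin m → Fin K)) :
    tropWeight d (fun i j l => v i (τ j) l) θ (q.1 * τ, q.2 ∘ τ) = tropWeight d v θ q := by
  unfold tropWeight
  have e1 : ∑ i, (d ((q.2 ∘ τ) i) : ℤ) = ∑ i, (d (q.2 i) : ℤ) := Equiv.sum_comp τ (fun i => (d (q.2 i) : ℤ))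
  have e2 : ∑ i, v ((q.1 * τ) i) (τ i) ((q.2 ∘ τ) i) = ∑ i, v (q.1 i) i (q.2 i) := by
    simp only [Equiv.Perm.coe_mul, Function.comp_apply]
    exact Equiv.sum_comp τ (fun i => v (q.1 i) i (q.2 i))
  rw [e1, e2]

/-- signs change by the sign of the column permutation. [folklore] -/
theorem termSign_colSwap (ε : Fin m → Fin m → Fin K → ℤ) (τ : Equiv.Perm (Fin m)) (q : Equiv.Perm (Fin m) × (Fin m → Fin K)) :
    termSign (fun i j l => ε i (τ j) l) (q.1 * τ, q.2 ∘ τ) = (Equiv.Perm.sign τ : ℤ) * termSign ε q := by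
  unfold termSign
  have e2 : ∏ i, ε ((q.1 * τ) i) (τ i) ((q.2 ∘ τ) i) = ∏ i, ε (q.1 i) i (q.2 i) := by
    simp only [Equiv.Perm.coe_mul, Function.comp_apply]
    exact Equiv.prod_comp τ (fun i => ε (q.1 i) i (q.2 i))
  rw [e2, Equiv.Perm.sign_mul]
  push_cast
  ring

/-- the column-swap of terms is injective. [folklore] -/
theorem colSwap_injective (τ : Equiv.Perm (Fin m)) :
    Function.Injective (fun q : Equiv.Perm (Fin m) × (Fin m → Fin K) => ((q.1 * τ, q.2 ∘ τ) : Equiv.Perm (Fin m) × (Fin m → Fin K))) := by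
  intro q q' h
  simp only [Prod.mk.injEq] at h
  obtain ⟨h1, h2⟩ := h
  refine Prod.ext (mul_right_cancel h1) (funext fun j => ?_)
  have := congrFun h2 (τ.symm j)
  simpa using this

/-- **dominance transfers to the column-swapped design.** [folklore] -/
theorem isDominant_colSwap (d : Fin K → ℕ) (v ε : Fin m → Fin m → Fin K → ℤ) (τ : Equiv.Perm (Fin m)) (θ : ℤ)
    {q : Equiv.Perm (Fin m) × (Fin m → Fin K)} (hq : IsDominant d v ε θ q) :
    IsDominant d (fun i j l => v i (τ j) l) (fun i j l => ε i (τ j) l) θ (q.1 * τ, q.2 ∘ τ) := by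
  have hsτ : (Equiv.Perm.sign τ : ℤ) ≠ 0 := by exact_mod_cast (Equiv.Perm.sign τ).ne_zero
  refine ⟨by rw [termSign_colSwap]; exact mul_ne_zero hsτ hq.1, fun q' hne hq' => ?_⟩
  -- pull `q'` back along the swap
  let r : Equiv.Perm (Fin m) × (Fin m → Fin K) := (q'.1 * τ⁻¹, q'.2 ∘ ⇑τ⁻¹)
  have hr : (r.1 * τ, r.2 ∘ τ) = q' := by
    refine Prod.ext (by simp [r]) (funext fun j => ?_)
    simp [r]
  rw [← hr, tropWeight_colSwap, tropWeight_colSwap]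
  refine hq.2 r (fun h => hne (by rw [← hr, h])) ?_
  have h1 := termSign_colSwap ε τ r
  rw [hr] at h1
  intro h0
  rw [h0, mul_zero] at h1
  exact hq' h1

/-! ## 3. Forced rotations -/

/-- a permutation with `σ (m−1) = 0` whose other columns stay in the (non-cyclic) band is the rotation `σ j = j + 1`. [folklore] -/
theorem perm_val_of_corner₁ (hm : 3 ≤ m) (σ : Equiv.Perm (Fin m)) (hlast : ((σ ⟨m - 1, by omega⟩ : Fin m) : ℕ) = 0)
    (hband : ∀ j : Fin m, (j : ℕ) < m - 1 → ((σ j : ℕ) ≤ j + 1 ∧ (j : ℕ) ≤ (σ j : ℕ) + 1)) :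
    ∀ j : Fin m, (j : ℕ) < m - 1 → ((σ j : Fin m) : ℕ) = j + 1 := by
  -- strong induction on the column
  have key : ∀ t : ℕ, ∀ j : Fin m, (j : ℕ) = t → t < m - 1 → ((σ j : Fin m) : ℕ) = t + 1 := by
    intro t
    induction t using Nat.strong_induction_on with
    | _ t ih =>
      intro j hj ht
      obtain ⟨h1, h2⟩ := hband j (by omega)
      -- `σ j ∈ {t-1, t, t+1}`; the values `t` and `t-1` are taken by the columns `t-1`, `t-2` (or by the last column when `t ≤ 1`)
      have hne_t : ((σ j : Fin m) : ℕ) ≠ t := by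
        intro h
        rcases Nat.eq_zero_or_pos t with h0 | h0
        · -- value `0` is taken by the last column
          have : σ j = σ ⟨m - 1, by omega⟩ := Fin.ext (by rw [h, hlast, h0])
          have := σ.injective this
          have := congrArg Fin.val this; simp at this; omega
        · have hprev := ih (t - 1) (by omega) ⟨t - 1, by omega⟩ rfl (by omega)
          have : σ j = σ ⟨t - 1, by omega⟩ := Fin.ext (by rw [h, hprev]; omega)
          have := congrArg Fin.val (σ.injective this); simp at this; omega
      have hne_tm : t ≥ 1 → ((σ j : Fin m) : ℕ) ≠ t - 1 := by
        intro ht1 h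
        rcases Nat.eq_or_lt_of_le ht1 with h1' | h1'
        · -- `t = 1`: value `0` is the last column's
          have : σ j = σ ⟨m - 1, by omega⟩ := Fin.ext (by rw [h, hlast]; omega)
          have := congrArg Fin.val (σ.injective this); simp at this; omega
        · have hprev := ih (t - 2) (by omega) ⟨t - 2, by omega⟩ rfl (by omega)
          have : σ j = σ ⟨t - 2, by omega⟩ := Fin.ext (by rw [h, hprev]; omega)
          have := congrArg Fin.val (σ.injective this); simp at this; omega
      rcases Nat.eq_zero_or_pos t with h0 | h0
      · omega
      · have := hne_tm h0; omega
  intro j hj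
  exact key j j rfl hj

/-- a permutation with `σ 0 = m−1` whose other columns stay in the band is the rotation `σ j = j − 1`. [folklore] -/
theorem perm_val_of_corner₂ (hm : 3 ≤ m) (σ : Equiv.Perm (Fin m)) (hfirst : ((σ ⟨0, by omega⟩ : Fin m) : ℕ) = m - 1)
    (hband : ∀ j : Fin m, 0 < (j : ℕ) → ((σ j : ℕ) ≤ j + 1 ∧ (j : ℕ) ≤ (σ j : ℕ) + 1)) :
    ∀ j : Fin m, 0 < (j : ℕ) → ((σ j : Fin m) : ℕ) + 1 = j := by
  -- strong induction downwards: on `s = m - 1 - j`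
  have key : ∀ s : ℕ, ∀ j : Fin m, (j : ℕ) + s = m - 1 → 0 < (j : ℕ) → ((σ j : Fin m) : ℕ) + 1 = j := by
    intro s
    induction s using Nat.strong_induction_on with
    | _ s ih =>
      intro j hj hjpos
      obtain ⟨h1, h2⟩ := hband j hjpos
      have hσlt : ((σ j : Fin m) : ℕ) < m := (σ j).isLt
      have hne_j : ((σ j : Fin m) : ℕ) ≠ j := by
        intro h
        rcases Nat.eq_zero_or_pos s with h0 | h0
        · -- `j = m - 1`: that value is the first column's
          have : σ j = σ ⟨0, by omega⟩ := Fin.ext (by rw [h, hfirst]; omega)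
          have := congrArg Fin.val (σ.injective this); simp at this; omega
        · have hprev := ih (s - 1) (by omega) ⟨(j : ℕ) + 1, by omega⟩ (by simp; omega) (by simp)
          have : σ j = σ ⟨(j : ℕ) + 1, by omega⟩ := Fin.ext (by rw [h]; simp at hprev ⊢; omega)
          have := congrArg Fin.val (σ.injective this); simp at this
      have hne_j1 : ((σ j : Fin m) : ℕ) ≠ j + 1 := by
        intro h
        rcases Nat.eq_zero_or_pos s with h0 | h0
        · omega
        · rcases Nat.eq_or_lt_of_le (show 1 ≤ s from h0) with h1' | h1'
          · -- `j + 1 = m - 1`: the first column's value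
            have : σ j = σ ⟨0, by omega⟩ := Fin.ext (by rw [h, hfirst]; omega)
            have := congrArg Fin.val (σ.injective this); simp at this; omega
          · have hprev := ih (s - 2) (by omega) ⟨(j : ℕ) + 2, by omega⟩ (by simp; omega) (by simp)
            have : σ j = σ ⟨(j : ℕ) + 2, by omega⟩ := Fin.ext (by rw [h]; simp at hprev ⊢; omega)
            have := congrArg Fin.val (σ.injective this); simp at this
      omega
  intro j hj
  exact key (m - 1 - j) j (by have := j.isLt; omega) hj

end StaticCyclicBand

end Summit.ValiantsHypothesis.ValiantsHypothesis.Theorems.KPlusLogSqLaw
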